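import Literature.AlgebraicGeometry.Frobenioids.Thm36Sub
import Literature.AlgebraicGeometry.Frobenioids.PerfectionIsotropic
import Literature.AlgebraicGeometry.Frobenioids.ArchimedeanFrobeniusIsotropic
import Literature.AlgebraicGeometry.Frobenioids.ArchimedeanPseudoTerminal
import Literature.AlgebraicGeometry.Frobenioids.ModelFrobenioidUnits
import Literature.AlgebraicGeometry.Frobenioids.RlfStructure
import Literature.AlgebraicGeometry.Frobenioids.ModelFrobenioidIsFrobenioid
import Literature.AlgebraicGeometry.Frobenioids.PadicFrobenioidIsFrobenioid
import HarnessLib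

/-!
# Frobenioids II, Theorem 3.6 (i) "`(C^ℚ)^istr = C^ℚ`" and (vi) for `C^ℚ := C^pf` — PROVED over THE perfection

Mochizuki, *The geometry of Frobenioids II: poly-Frobenioids*, Kyushu J. Math. **62** (2008) 401–460, §3,
Theorem 3.6 (i) p. 36 ("If `Λ ≥ ℚ`, then `(C^Λ)^istr = C^Λ`") and (vi) p. 37 ("If `D` admits a pseudo-terminal
object, then `F` admits a pseudo-terminal object"), for `F = C^ℚ := C^pf` (Example 3.3 (ii) p. 28), read on the
kurims text `paper:url-4322d76898e0` [cite: MochizukiFrdII2008, Thm 3.6 (i) p.36].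

PROOF-ONLY companion of the sub-DAG statements file `Thm36Sub.lean` (abc-iut cell, L1 row M13): closes the
slots `Thm36Sub.istrAll_Q` and `Thm36Sub.vi_Q` for THE perfection `PreFrobenioid.Perfection hF` of the
Frobenioid `C → F_Φ` (hypothesis `hF`, print's "`C` is a Frobenioid"), unconditionally in everything else:
* (i) every object of `C^pf` is isotropic — [FrdI] Prop. 3.2 (iii) for THE perfection
  (`PreFrobenioid.Perfection.isOfIsotropicType_perfection`, seat abc-iut-L1-d9) applied to "`C` is of
  Frobenius-isotropic type" (Ex. 3.3 (ii), PROVED: `ArchFrd.Ex33ii_frobeniusIsotropic_holds`), read back on the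
  structure functor through `PreFrobenioidData.ofFunctor_toFunctor` / `ofFunctor_isIsotropic`;
* (vi) if `A ∈ C` is pseudo-terminal (`thm36vi_C`), then the root `(A, 1) ∈ C^pf` is pseudo-terminal: an object
  `(B, m)` maps to it by the class, at level `(1, m)`, of `B^{(1)} → A → A^{(m)}` (any arrow to `A` followed by
  the chosen Frobenius morphism of degree `m`).
Theorems only; nothing here takes a side on [IUTchIII] Cor. 3.12.
-/

namespace Literature.AlgebraicGeometry.Frobenioids

open CategoryTheory Opposite

universe v u

namespace ArchFrd

namespace Thm36Sub

variable {D : Type u} [Category.{v} D] (π : D ⥤ D0)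

/-- **Thm. 3.6 (i) for `C^ℚ = C^pf`**, "If `Λ ≥ ℚ`, then `(C^Λ)^istr = C^Λ`" (p. 36): every object of THE
perfection of `C` is isotropic — PROVED ([FrdI] Prop. 3.2 (iii) for the perfection + Ex. 3.3 (ii) "`C` is of
Frobenius-isotropic type"). Closes the slot `Thm36Sub.istrAll_Q`; the binder `hF` is the PARAMETER of that
slot (the input of d9's construction of `C^pf`, print's "`C` is a Frobenioid"), not a hypothesis of the claim —
the closed form is `∀ hF, istrAll_Q π hF`, which is this theorem. [cite: MochizukiFrdII2008, Thm 3.6 (i) p.36] -/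
theorem istrAll_Q_holds (hF : PreFrobenioid.IsFrobenioid (C.toElem π)) :
    Literature.AlgebraicGeometry.Frobenioids.ArchFrd.Thm36Sub.istrAll_Q π hF := by
  intro _ X
  have h := (PreFrobenioid.Perfection.isOfIsotropicType_perfection hF (Ex33ii_frobeniusIsotropic_holds π)).obj X
  rw [← PreFrobenioidData.ofFunctor_isIsotropic]
  exact h

/-- In THE perfection, the root `(A, 1)` of a pseudo-terminal object `A` of `C` is pseudo-terminal: `(B, m)` maps
to `(A, 1)` by the class at level `(1, m)` of `B^{(1)} → A → A^{(m)}`. [cite: MochizukiFrdII2008, Thm 3.6 (vi) p.37] -/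
theorem isPseudoTerminal_root (hF : PreFrobenioid.IsFrobenioid (C.toElem π)) {A : C π}
    (hA : IsPseudoTerminal A) : IsPseudoTerminal (PreFrobenioid.Perfection.root hF A 1) := by
  intro Y
  obtain ⟨ψ⟩ := hA (PreFrobenioid.frobPow hF Y.obj 1)
  exact ⟨PreFrobenioid.Perfection.Hom.mk
    ⟨⟨1, Y.idx, by rw [mul_one, one_mul]⟩, ψ ≫ PreFrobenioid.frob hF A Y.idx⟩⟩

/-- **Thm. 3.6 (vi) for `C^ℚ = C^pf`** (p. 37): "If `D` admits a pseudo-terminal object, then `F` admits a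
pseudo-terminal object" — PROVED for THE perfection (via `thm36vi_C` and `isPseudoTerminal_root`). Closes the
slot `Thm36Sub.vi_Q` (for every value of its parameter `hF`, the input of the construction of `C^pf`), i.e. the
`Λ = ℚ` conjunct of the instance `Thm36vi_CA` at `pf := pfCompletion hF` (`thm36vi_instance_Q_iff`).
[cite: MochizukiFrdII2008, Thm 3.6 (vi) p.37] -/
theorem vi_Q_holds (hF : PreFrobenioid.IsFrobenioid (C.toElem π)) :
    Literature.AlgebraicGeometry.Frobenioids.ArchFrd.Thm36Sub.vi_Q π hF := by
  intro hD
  obtain ⟨A, hA⟩ := thm36vi_C π hD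
  exact ⟨PreFrobenioid.Perfection.root hF A 1, isPseudoTerminal_root π hF hA⟩

/-- The `Λ = ℚ` conjunct of t9's instance `Thm36vi_CA π (pfCompletion hF) rlf` holds (for every `rlf`).
[cite: MochizukiFrdII2008, Thm 3.6 (vi) p.37] -/
theorem thm36vi_instance_Q (hF : PreFrobenioid.IsFrobenioid (C.toElem π)) (rlf : LambdaCompletion π) :
    Thm36vi D (archFrobenioid π (pfCompletion π hF) rlf .Q).cat :=
  (thm36vi_instance_Q_iff π hF rlf).2 (vi_Q_holds π hF)

/-- The `Λ = ℚ` conjunct of t9's instance `Thm36i_istr_all_C π (pfCompletion hF) rlf` holds.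
[cite: MochizukiFrdII2008, Thm 3.6 (i) p.36] -/
theorem thm36i_istr_all_instance_Q (hF : PreFrobenioid.IsFrobenioid (C.toElem π)) (rlf : LambdaCompletion π) :
    Thm36i_istr_all (archFrobenioid π (pfCompletion π hF) rlf .Q).str .Q :=
  istrAll_Q_holds π hF


/-! ### Theorem 3.6 (i) for `C^ℝ = C^rlf`: "`(C^ℝ)^istr = C^ℝ`" -/

/-- The rational-function monoid `ℝ · Φ^birat` of THE realification is (objectwise) group-like — it is a
subfunctor of GROUPS of `(Φ^rlf)^gp` ([FrdI] Prop. 5.3: "the rational function monoid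
`ℝ · Φ^birat ⊆ (Φ^rlf)^gp`"; the hypothesis of [FrdI] Thm. 5.2 on the datum `B`).
[cite: MochizukiFrdI2008, Prop. 5.3 p.103] -/
theorem rlf_objectwise_isGroupLike :
    Objectwise (fun M _ => IsGroupLike M)
      (((RealificationData.canonical (Φ π)
          (PreFrobenioid.IsPerfFactorialOn.op (isPerfFactorialOn_Φ π))).realSpan
        (PreFrobenioid.biratSubfunctor (C.toElem π))).toMonoid) :=
  fun A => isGroupLike_of_forall_isUnit (GpSubfunctor.isUnit_toMonoid _ (Opposite.op A))

/-- **Thm. 3.6 (i) for `C^ℝ = C^rlf`**, "If `Λ ≥ ℚ`, then `(C^Λ)^istr = C^Λ`" (p. 36): every object of THE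
realification is isotropic — PROVED ([FrdI] Thm. 5.2 (ii) "the model Frobenioid is of isotropic type",
seat abc-iut-L1-t2's `ModelFrobenioid.isOfIsotropicType`, at the data `(Φ^rlf, ℝ · Φ^birat)`). Closes the
slot `Thm36Sub.istrAll_R`. [cite: MochizukiFrdII2008, Thm 3.6 (i) p.36] -/
theorem istrAll_R_holds : Literature.AlgebraicGeometry.Frobenioids.ArchFrd.Thm36Sub.istrAll_R π :=
  fun _ => ModelFrobenioid.isOfIsotropicType (rlf_objectwise_isGroupLike π)

/-! ### Theorem 3.6 (v) for `C^ℝ = C^rlf`: "(c) `Λ = ℝ`" — every `O^×(A)` is trivial -/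

/-- **`O^×` is trivial in THE realification**: a base-identity linear automorphism `α` of an object
`(A_D, a)` of `C^rlf` (the model Frobenioid of `(Φ^rlf, ℝ · Φ^birat ↪ (Φ^rlf)^gp)`) has `Div(α) = 1`
(`Φ^rlf(A_D)` is sharp) hence `u_α = 1` (`Div_B` is an inclusion), hence `α = 1` (`Φ^rlf(A_D)` is
integral; seat abc-iut-L1-t2's `ModelFrobenioid.unitsToRatFn_injective`). This is the content of
Thm. 3.6 (v) (c) for `C^ℝ` (p. 37: "`O^×(A)` is trivial if … (c) `Λ = ℝ`"); exported for the (x) slot.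
[cite: MochizukiFrdII2008, Thm 3.6 (v) p.37] -/
theorem rlf_unitsSubgroup_eq_bot (Y : rlfCat π) : PreFrobenioid.unitsSubgroup (rlfStr π) Y = ⊥ := by
  refine (Subgroup.eq_bot_iff_forall _).2 fun α hα => ?_
  have hα' : α ∈ ModelFrobenioid.units Y := hα
  have h' := PreFrobenioid.IsPerfFactorialOn.op (isPerfFactorialOn_Φ π)
  have hsharp : IsSharp ((Literature.AnabelianGeometry.EtaleTheta.rlfFunctor (Φ π) h').obj
      (Opposite.op Y.base)) := IsPerfFactorial.Rlf.isSharp (h' (Opposite.op Y.base))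
  have hint : IsIntegral ((Literature.AnabelianGeometry.EtaleTheta.rlfFunctor (Φ π) h').obj
      (Opposite.op Y.base)) := IsPerfFactorial.Rlf.isIntegral (h' (Opposite.op Y.base))
  have h1 := ModelFrobenioid.divB_unitsToRatFn_eq_one hsharp ⟨α, hα'⟩
  have h2 : ModelFrobenioid.unitsToRatFn Y ⟨α, hα'⟩ = 1 := by
    apply Units.ext
    exact Subtype.ext h1
  have h3 : (⟨α, hα'⟩ : ModelFrobenioid.units Y) = 1 :=
    ModelFrobenioid.unitsToRatFn_injective hint (h2.trans (map_one _).symm)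
  exact congrArg Subtype.val h3

/-- **Thm. 3.6 (v) for `C^ℝ = C^rlf`** (p. 37), all six clauses at `Λ = ℝ` — PROVED: every `O^×(A)` is
trivial ("(c) `Λ = ℝ`"), hence never "nontrivial torsion-free", never of order two, never with infinitely
many torsion elements; the `ℚ`- and `ℤ`-guarded brackets are vacuous. Closes the slot `Thm36Sub.v_R` (the
`Λ = ℝ` conjunct of the instance `Thm36v_C` over THE realification). [cite: MochizukiFrdII2008, Thm 3.6 (v) p.37] -/
theorem v_R_holds : Literature.AlgebraicGeometry.Frobenioids.ArchFrd.Thm36Sub.v_R π := by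
  refine ⟨fun Y => ⟨fun _ => Or.inr (Or.inr rfl), fun _ => rlf_unitsSubgroup_eq_bot π Y⟩, fun Y => ?_,
    fun h => absurd h (by decide), fun Y => ?_, fun Y => ?_, fun h => absurd h (by decide)⟩
  · -- torsion-free clause: both sides are false
    constructor
    · rintro ⟨hne, -⟩
      exact absurd (rlf_unitsSubgroup_eq_bot π Y) hne
    · rintro ⟨h, -⟩
      exact absurd h (by decide)
  · -- order two: `|O^×(A)| = 1 ≠ 2`
    constructor
    · intro h
      rw [rlf_unitsSubgroup_eq_bot π Y, Subgroup.card_bot] at h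
      exact absurd h (by decide)
    · rintro ⟨h, -⟩
      exact absurd h (by decide)
  · -- infinitely many torsion elements: the unit group is trivial, hence finite
    constructor
    · intro h
      haveI : Finite (PreFrobenioid.unitsSubgroup (rlfStr π) Y) := by
        rw [rlf_unitsSubgroup_eq_bot π Y]; infer_instance
      exact absurd (Set.toFinite _) h
    · rintro ⟨h, -⟩
      exact absurd h (by decide)

end Thm36Sub

end ArchFrd

end Literature.AlgebraicGeometry.Frobenioids
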